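import Summits.BirchSwinnertonDyer.BirchSwinnertonDyer.Theorems.ByReductionTypeAtTwoRankOneSigmaHeightLevelOne
import HarnessLib

/-!
# Route `ByReductionTypeAtTwo`, crux `RankOneAtTwoBigImageOddLocal` (item stmt-BirchSwinnertonDyer-23715), line AN62, σ₀-LEMMA BLOCK
# (cell `bsd-f1-sign2`, planner seat `-an` g50; `--supports 23715`, helper; sequel of `…SigmaHeightLevelOne`):
# **LEVEL ONE, part 2: GIVEN Néron's duplication numerator `num x(2Q) = a⁴ − b₄a²d² − 2b₆ad³ − b₈d⁴`, the level-one law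
# `⟨Q,Q⟩ ≡ log₂ num x(Q) − 8a₄ (mod 32)` and `‖⟨Q,Q⟩‖₂ = ¼ ⟺ a₂ odd`**

HONEST FRAMING (D-0036/D-0054): THEOREMS ONLY (no definition, no named fact, no `sorry`, no instance).  Setting as in the prequels:
`V/ℚ` `ℤ`-integral with `a₁ = 0`, `Σ₀` its even constant-`0` sigma-squared series at `2`, `D : PAdicHeightData V 2` any height datum whose
quadratic form is `log₂ den x − log₂ Σ₀(−x/y)` on the local-conditions locus at `2` (verbatim the conclusion of `exists_heightData_sigmaSqZero_two`).
A level-one point `Q` (`‖x‖₂ = 4`) is reached through `⟨Q,Q⟩ = ¼⟨2Q,2Q⟩`.  Nothing here is a statement about `BSDp`; item 23715 stays OPEN;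
BSD is proved for no curve.

* §7 **`norm_pairing_sub_padicLog_num_add_le_of_duplication`** (MEMO-an 54B, kernel form): if `2·Q = (x', y')` lies in the locus and
  `num x' = a⁴ − b₄a²d² − 2b₆ad³ − b₈d⁴` (`a = num x`, `d = den x`; Néron: no cancellation in the duplication formula for a point with
  non-singular reduction everywhere — an explicit HYPOTHESIS here, certified row by row in the cell's census, 2 949/2 949), then
  **`‖⟨Q,Q⟩ − log₂ num x + 8a₄‖₂ ≤ 1/32`**; proof: the effective Tate formula at `k = 1` (`‖⟨Q,Q⟩ − ¼log₂ num x'‖₂ ≤ 8‖x'‖₂⁻² ≤ 1/32`),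
  `num x'/a⁴ = 1 − 32a₄δ²/a² + O(2⁷)` (`d = 4δ`), `δ² ≡ a² (mod 8)`, `log₂(1+w) = w + O(2w²)`.
  Corollaries `norm_pairing_le_quarter_of_duplication` (`‖⟨Q,Q⟩‖₂ ≤ ¼`) and **`norm_pairing_eq_quarter_iff_of_duplication`:
  `‖⟨Q,Q⟩‖₂ = ¼ ⟺ a₂ odd`** — the level-one η-height valuation law observed in the cell's census (CensusAN52: 1 639/1 639), kernel
  modulo the displayed duplication hypothesis.

PLACEMENT: corollary-of-print ∘ kernel.  References: [cite: MazurSteinTate2006, §1 (1.1), §2.6, §4] [cite: SilvermanAEC2009, III.2.3(d), VIII.9]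
[cite: Wuthrich2004, §2 (integrality of division values)] [cite: Iwasawa1972PadicL, §4.4].
-/

set_option autoImplicit false

noncomputable section

open scoped Classical

open PowerSeries WeierstrassCurve Literature Literature.NumberTheory.EllipticCurves

namespace Summit.BirchSwinnertonDyer.BirchSwinnertonDyer.Theorems

namespace NaiveSigmaLogAtTwo

/-! ### §7 The level-one law, given Néron's duplication numerator -/

/-- **54B — THE LEVEL-ONE LAW, given Néron's duplication numerator (kernel)**: `V/ℚ` `ℤ`-integral, `a₁ = 0`, `D` a height datum with the
naive σ-form on the locus at `2`; `Q = (x, y)` with `‖x‖₂ = 4` and `2·Q = (x', y')` in the locus; IF `num x' = a⁴ − b₄a²d² − 2b₆ad³ − b₈d⁴`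
(`a = num x`, `d = den x`, `b₄ = 2a₄`, `b₆ = a₃² + 4a₆`, `b₈ = 4a₂a₆ + a₂a₃² − a₄²` at `a₁ = 0`), THEN **`‖⟨Q,Q⟩ − log₂ num x + 8a₄‖₂ ≤ 1/32`**.
[cite: MazurSteinTate2006, §1, §2.6] [cite: SilvermanAEC2009, III.2.3(d), VIII.9] [cite: Wuthrich2004, §2] -/
theorem norm_pairing_sub_padicLog_num_add_le_of_duplication (V : WeierstrassCurve ℚ) [V.IsIntegral ℤ] (ha1 : V.a₁ = 0)
    (Sq : ℚ_[2]⟦X⟧) (h0 : constantCoeff Sq = 0) (h1 : coeff 1 Sq = 0) (h2 : coeff 2 Sq = 1) (h3 : coeff 3 Sq = 0)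
    (hODE : (V.baseChange ℚ_[2]).SatisfiesSigmaSqODE Sq 0) (D : PAdicHeightData V 2)
    (hD : ∀ {x y : ℚ} (h : V.toAffine.Nonsingular x y), V.SatisfiesLocalConditions 2 (.some x y h) →
      D.pairing (.some x y h) (.some x y h) = padicLog 2 ((x.den : ℚ) : ℚ_[2]) - padicLog 2 (padicEval Sq (-(x : ℚ_[2]) / y)))
    {x y x' y' : ℚ} (h : V.toAffine.Nonsingular x y) (h' : V.toAffine.Nonsingular x' y')
    (h2Q : ((2 ^ 1 : ℕ)) • (.some x y h : V.toAffine.Point) = .some x' y' h') (hQ' : V.SatisfiesLocalConditions 2 (.some x' y' h'))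
    (hx : ‖(x : ℚ_[2])‖ = 4)
    (hN : (x'.num : ℚ) = (x.num : ℚ) ^ 4 - 2 * V.a₄ * (x.num : ℚ) ^ 2 * (x.den : ℚ) ^ 2
      - 2 * (V.a₃ ^ 2 + 4 * V.a₆) * (x.num : ℚ) * (x.den : ℚ) ^ 3 - (4 * V.a₂ * V.a₆ + V.a₂ * V.a₃ ^ 2 - V.a₄ ^ 2) * (x.den : ℚ) ^ 4) :
    ‖D.pairing (.some x y h) (.some x y h) - padicLog 2 (x.num : ℚ_[2]) + 8 * (V.a₄ : ℚ_[2])‖ ≤ 32⁻¹ := by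
  have hx1 : 1 < ‖(x : ℚ_[2])‖ := by rw [hx]; norm_num
  obtain ⟨hxo, -⟩ := odd_num_and_odd_num V h hx1
  have hx16 := sixteen_le_norm_of_satisfiesLocalConditions_two V h' hQ'
  -- the effective Tate formula at `k = 1`
  have hT := norm_pairing_sub_inv_mul_padicLog_num_le V ha1 Sq h0 h1 h2 h3 hODE D hD (.some x y h) 1 h' h2Q hQ'
  have hT' : ‖D.pairing (.some x y h) (.some x y h) - ((4 : ℚ_[2]) ^ 1)⁻¹ * padicLog 2 (x'.num : ℚ_[2])‖ ≤ 32⁻¹ := by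
    refine hT.trans ?_
    have hi : ‖(x' : ℚ_[2])‖⁻¹ ≤ 16⁻¹ := inv_anti₀ (by norm_num) hx16
    have hi0 : 0 ≤ ‖(x' : ℚ_[2])‖⁻¹ := by positivity
    nlinarith [hi, hi0]
  -- integrality and units
  have hA2 : ‖(V.a₂ : ℚ_[2])‖ ≤ 1 := (mem_localIntegers_iff 2 _).mp (V.a₂_mem_localIntegers 2)
  have hA3 : ‖(V.a₃ : ℚ_[2])‖ ≤ 1 := (mem_localIntegers_iff 2 _).mp (V.a₃_mem_localIntegers 2)
  have hA4 : ‖(V.a₄ : ℚ_[2])‖ ≤ 1 := (mem_localIntegers_iff 2 _).mp (V.a₄_mem_localIntegers 2)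
  have hA6 : ‖(V.a₆ : ℚ_[2])‖ ≤ 1 := (mem_localIntegers_iff 2 _).mp (V.a₆_mem_localIntegers 2)
  set A : ℚ_[2] := (x.num : ℚ_[2]) with hAdef
  set dX : ℚ_[2] := (x.den : ℚ_[2]) with hdXdef
  have hnA : ‖A‖ = 1 := by rw [hAdef]; exact DepletionAtTwo.norm_intCast_eq_one_of_odd hxo
  have hA0 : A ≠ 0 := fun e => by rw [e, norm_zero] at hnA; exact zero_ne_one hnA
  have hndX : ‖dX‖ = 4⁻¹ := by rw [hdXdef, norm_natCast_den_eq x, max_eq_right hx1.le, hx]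
  have hAsq : ‖A ^ 2 - 1‖ ≤ 8⁻¹ := by rw [hAdef]; exact norm_sq_sub_one_le_of_odd hxo
  -- `d = 4δ`, `δ` odd
  have hdvd : (2 : ℤ) ^ 2 ∣ (x.den : ℤ) := (Padic.norm_int_le_pow_iff_dvd (p := 2) (x.den : ℤ) 2).mp (by
    rw [Int.cast_natCast, ← hdXdef, hndX]; norm_num)
  obtain ⟨δ, hδ⟩ := hdvd
  have hδc : dX = 4 * (δ : ℚ_[2]) := by
    rw [hdXdef, show ((x.den : ℕ) : ℚ_[2]) = ((x.den : ℤ) : ℚ_[2]) by norm_cast, hδ]; push_cast; ring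
  have h4n : ‖(4 : ℚ_[2])‖ = 4⁻¹ := by
    rw [show (4 : ℚ_[2]) = 2 * 2 by norm_num, norm_mul, Rank2Observatory.padic_norm_two]; norm_num
  have hδ1 : ‖(δ : ℚ_[2])‖ = 1 := by
    have := hndX; rw [hδc, norm_mul, h4n] at this
    linarith
  have hδodd : Odd δ := by
    rw [← Int.not_even_iff_odd, even_iff_two_dvd]
    intro h2
    have := Padic.norm_intCast_lt_one_iff.mpr (by exact_mod_cast h2 : (2 : ℤ) ∣ δ)
    rw [hδ1] at this; exact lt_irrefl _ this
  have hδsq : ‖(δ : ℚ_[2]) ^ 2 - 1‖ ≤ 8⁻¹ := norm_sq_sub_one_le_of_odd hδodd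
  -- the duplication numerator in `ℚ₂`
  set N : ℚ_[2] := (x'.num : ℚ_[2]) with hNdef
  have hNeq : N = A ^ 4 - 2 * (V.a₄ : ℚ_[2]) * A ^ 2 * dX ^ 2 - 2 * ((V.a₃ : ℚ_[2]) ^ 2 + 4 * (V.a₆ : ℚ_[2])) * A * dX ^ 3
      - (4 * (V.a₂ : ℚ_[2]) * (V.a₆ : ℚ_[2]) + (V.a₂ : ℚ_[2]) * (V.a₃ : ℚ_[2]) ^ 2 - (V.a₄ : ℚ_[2]) ^ 2) * dX ^ 4 := by
    have e := congrArg (fun q : ℚ => (q : ℚ_[2])) hN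
    push_cast at e
    rw [hNdef, hAdef, hdXdef]; linear_combination e
  -- `w := N/A⁴ − 1`, with `‖w + 32a₄‖ ≤ 1/128`
  set w : ℚ_[2] := N / A ^ 4 - 1 with hwdef
  have hA40 : A ^ 4 ≠ 0 := pow_ne_zero 4 hA0
  have hwexp : w = -(32 * (V.a₄ : ℚ_[2])) * ((δ : ℚ_[2]) ^ 2 / A ^ 2)
      - 128 * ((V.a₃ : ℚ_[2]) ^ 2 + 4 * (V.a₆ : ℚ_[2])) * ((δ : ℚ_[2]) ^ 3 / A ^ 3)
      - 256 * (4 * (V.a₂ : ℚ_[2]) * (V.a₆ : ℚ_[2]) + (V.a₂ : ℚ_[2]) * (V.a₃ : ℚ_[2]) ^ 2 - (V.a₄ : ℚ_[2]) ^ 2) *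
        ((δ : ℚ_[2]) ^ 4 / A ^ 4) := by
    rw [hwdef, hNeq, hδc]
    field_simp
    ring
  have h2n : ‖(2 : ℚ_[2])‖ = 2⁻¹ := Rank2Observatory.padic_norm_two
  have hpow2 : ∀ k : ℕ, ‖((2 : ℚ_[2]) ^ k)‖ = (2⁻¹ : ℝ) ^ k := fun k => by rw [norm_pow, h2n]
  have hq : ∀ k : ℕ, ‖(δ : ℚ_[2]) ^ k / A ^ k‖ = 1 := fun k => by
    rw [norm_div, norm_pow, norm_pow, hδ1, hnA, one_pow, div_one]
  have hB6 : ‖(V.a₃ : ℚ_[2]) ^ 2 + 4 * (V.a₆ : ℚ_[2])‖ ≤ 1 := by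
    refine (IsUltrametricDist.norm_add_le_max _ _).trans (max_le ?_ ?_)
    · rw [norm_pow]; exact pow_le_one₀ (norm_nonneg _) hA3
    · rw [norm_mul, show (4 : ℚ_[2]) = 2 ^ 2 by norm_num, hpow2]
      calc ((2⁻¹ : ℝ) ^ 2) * ‖(V.a₆ : ℚ_[2])‖ ≤ (2⁻¹ : ℝ) ^ 2 * 1 := by gcongr
        _ ≤ 1 := by norm_num
  have hB8 : ‖4 * (V.a₂ : ℚ_[2]) * (V.a₆ : ℚ_[2]) + (V.a₂ : ℚ_[2]) * (V.a₃ : ℚ_[2]) ^ 2 - (V.a₄ : ℚ_[2]) ^ 2‖ ≤ 1 := by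
    rw [sub_eq_add_neg]
    refine (IsUltrametricDist.norm_add_le_max _ _).trans (max_le ?_ ?_)
    · refine (IsUltrametricDist.norm_add_le_max _ _).trans (max_le ?_ ?_)
      · rw [norm_mul, norm_mul, show (4 : ℚ_[2]) = 2 ^ 2 by norm_num, hpow2]
        calc ((2⁻¹ : ℝ) ^ 2) * ‖(V.a₂ : ℚ_[2])‖ * ‖(V.a₆ : ℚ_[2])‖ ≤ (2⁻¹ : ℝ) ^ 2 * 1 * 1 := by gcongr
          _ ≤ 1 := by norm_num
      · rw [norm_mul, norm_pow]
        calc ‖(V.a₂ : ℚ_[2])‖ * ‖(V.a₃ : ℚ_[2])‖ ^ 2 ≤ 1 * 1 ^ 2 := by gcongr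
          _ = 1 := by norm_num
    · rw [norm_neg, norm_pow]; exact pow_le_one₀ (norm_nonneg _) hA4
  have hw32 : ‖w + 32 * (V.a₄ : ℚ_[2])‖ ≤ 128⁻¹ := by
    have e : w + 32 * (V.a₄ : ℚ_[2]) = 32 * (V.a₄ : ℚ_[2]) * ((A ^ 2 - 1) + -((δ : ℚ_[2]) ^ 2 - 1)) / A ^ 2
        + -(128 * ((V.a₃ : ℚ_[2]) ^ 2 + 4 * (V.a₆ : ℚ_[2])) * ((δ : ℚ_[2]) ^ 3 / A ^ 3))
        + -(256 * (4 * (V.a₂ : ℚ_[2]) * (V.a₆ : ℚ_[2]) + (V.a₂ : ℚ_[2]) * (V.a₃ : ℚ_[2]) ^ 2 - (V.a₄ : ℚ_[2]) ^ 2) *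
          ((δ : ℚ_[2]) ^ 4 / A ^ 4)) := by
      rw [hwexp]; field_simp; ring
    rw [e]
    have hsq2 : ‖(A ^ 2 - 1) + -((δ : ℚ_[2]) ^ 2 - 1)‖ ≤ 8⁻¹ :=
      (IsUltrametricDist.norm_add_le_max _ _).trans (max_le hAsq (by rw [norm_neg]; exact hδsq))
    refine (IsUltrametricDist.norm_add_le_max _ _).trans (max_le ?_ ?_)
    · refine (IsUltrametricDist.norm_add_le_max _ _).trans (max_le ?_ ?_)
      · rw [norm_div, norm_mul, norm_mul, norm_pow, hnA, one_pow, div_one, show (32 : ℚ_[2]) = 2 ^ 5 by norm_num, hpow2]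
        calc ((2⁻¹ : ℝ) ^ 5) * ‖(V.a₄ : ℚ_[2])‖ * ‖(A ^ 2 - 1) + -((δ : ℚ_[2]) ^ 2 - 1)‖ ≤ (2⁻¹ : ℝ) ^ 5 * 1 * 8⁻¹ := by gcongr
          _ ≤ 128⁻¹ := by norm_num
      · rw [norm_neg, norm_mul, norm_mul, hq, mul_one, show (128 : ℚ_[2]) = 2 ^ 7 by norm_num, hpow2]
        calc ((2⁻¹ : ℝ) ^ 7) * ‖(V.a₃ : ℚ_[2]) ^ 2 + 4 * (V.a₆ : ℚ_[2])‖ ≤ (2⁻¹ : ℝ) ^ 7 * 1 := by gcongr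
          _ = 128⁻¹ := by norm_num
    · rw [norm_neg, norm_mul, norm_mul, hq, mul_one, show (256 : ℚ_[2]) = 2 ^ 8 by norm_num, hpow2]
      calc ((2⁻¹ : ℝ) ^ 8) * ‖4 * (V.a₂ : ℚ_[2]) * (V.a₆ : ℚ_[2]) + (V.a₂ : ℚ_[2]) * (V.a₃ : ℚ_[2]) ^ 2 - (V.a₄ : ℚ_[2]) ^ 2‖
          ≤ (2⁻¹ : ℝ) ^ 8 * 1 := by gcongr
        _ ≤ 128⁻¹ := by norm_num
  have h32a4 : ‖(32 : ℚ_[2]) * (V.a₄ : ℚ_[2])‖ ≤ 32⁻¹ := by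
    rw [norm_mul, show (32 : ℚ_[2]) = 2 ^ 5 by norm_num, hpow2]
    calc ((2⁻¹ : ℝ) ^ 5) * ‖(V.a₄ : ℚ_[2])‖ ≤ (2⁻¹ : ℝ) ^ 5 * 1 := by gcongr
      _ = 32⁻¹ := by norm_num
  have hw : ‖w‖ ≤ 32⁻¹ := by
    rw [show w = (w + 32 * (V.a₄ : ℚ_[2])) + -(32 * (V.a₄ : ℚ_[2])) by ring]
    exact (IsUltrametricDist.norm_add_le_max _ _).trans (max_le (hw32.trans (by norm_num)) (by rw [norm_neg]; exact h32a4))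
  -- logarithms: `log N = 4 log A + log(1 + w)`
  have h1w : ‖1 - (1 + w)‖ < 1 := by
    rw [sub_add_cancel_left, norm_neg]; exact lt_of_le_of_lt hw (by norm_num)
  have h1w0 : 1 + w ≠ 0 := by
    intro e; rw [e, sub_zero, norm_one] at h1w; exact lt_irrefl _ h1w
  have hNfac : N = (A ^ 2) ^ 2 * (1 + w) := by
    rw [hwdef]; field_simp; ring
  have hN0 : N ≠ 0 := by rw [hNfac]; exact mul_ne_zero (pow_ne_zero 2 (pow_ne_zero 2 hA0)) h1w0
  have hlogN : padicLog 2 N = 4 * padicLog 2 A + padicLog 2 (1 + w) := by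
    rw [hNfac, padicLog_mul_holds 2 (pow_ne_zero 2 (pow_ne_zero 2 hA0)) h1w0, padicLog_sq (pow_ne_zero 2 hA0), padicLog_sq hA0]
    ring
  have hE : ‖padicLog 2 (1 + w) - w‖ ≤ 512⁻¹ := by
    rw [padicLog_eq_padicLogSeries h1w]
    have hh := norm_padicLogSeries_add_le (p := 2) h1w
    rw [show (1 : ℚ_[2]) - (1 + w) = -w by ring, norm_neg, ← sub_eq_add_neg] at hh
    have h2i : ‖(2 : ℚ_[2])⁻¹‖ = 2 := by rw [norm_inv, h2n, inv_inv]
    calc ‖padicLogSeries 2 (1 + w) - w‖ ≤ ‖w‖ ^ 2 * ‖(2 : ℚ_[2])⁻¹‖ := hh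
      _ ≤ (32⁻¹ : ℝ) ^ 2 * 2 := by rw [h2i]; gcongr
      _ = 512⁻¹ := by norm_num
  -- `¼ log N − log A + 8a₄ = ¼ (log(1+w) − w) + ¼ (w + 32 a₄)`
  have hid : ((4 : ℚ_[2]) ^ 1)⁻¹ * padicLog 2 N - padicLog 2 A + 8 * (V.a₄ : ℚ_[2]) =
      (4 : ℚ_[2])⁻¹ * ((padicLog 2 (1 + w) - w) + (w + 32 * (V.a₄ : ℚ_[2]))) := by
    rw [hlogN]; field_simp; ring
  have h4i : ‖(4 : ℚ_[2])⁻¹‖ = 4 := by rw [norm_inv, h4n, inv_inv]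
  have harith : ‖((4 : ℚ_[2]) ^ 1)⁻¹ * padicLog 2 N - padicLog 2 A + 8 * (V.a₄ : ℚ_[2])‖ ≤ 32⁻¹ := by
    rw [hid, norm_mul, h4i]
    calc (4 : ℝ) * ‖(padicLog 2 (1 + w) - w) + (w + 32 * (V.a₄ : ℚ_[2]))‖ ≤ 4 * 128⁻¹ := by
          gcongr
          exact (IsUltrametricDist.norm_add_le_max _ _).trans (max_le (hE.trans (by norm_num)) hw32)
      _ = 32⁻¹ := by norm_num
  -- assemble
  have e : D.pairing (.some x y h) (.some x y h) - padicLog 2 A + 8 * (V.a₄ : ℚ_[2]) =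
      (D.pairing (.some x y h) (.some x y h) - ((4 : ℚ_[2]) ^ 1)⁻¹ * padicLog 2 N) +
        (((4 : ℚ_[2]) ^ 1)⁻¹ * padicLog 2 N - padicLog 2 A + 8 * (V.a₄ : ℚ_[2])) := by ring
  rw [e]
  exact (IsUltrametricDist.norm_add_le_max _ _).trans (max_le hT' harith)

/-- Corollary: **`‖⟨Q,Q⟩‖₂ ≤ ¼` at level one** (same hypotheses). -/
theorem norm_pairing_le_quarter_of_duplication (V : WeierstrassCurve ℚ) [V.IsIntegral ℤ] (ha1 : V.a₁ = 0)
    (Sq : ℚ_[2]⟦X⟧) (h0 : constantCoeff Sq = 0) (h1 : coeff 1 Sq = 0) (h2 : coeff 2 Sq = 1) (h3 : coeff 3 Sq = 0)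
    (hODE : (V.baseChange ℚ_[2]).SatisfiesSigmaSqODE Sq 0) (D : PAdicHeightData V 2)
    (hD : ∀ {x y : ℚ} (h : V.toAffine.Nonsingular x y), V.SatisfiesLocalConditions 2 (.some x y h) →
      D.pairing (.some x y h) (.some x y h) = padicLog 2 ((x.den : ℚ) : ℚ_[2]) - padicLog 2 (padicEval Sq (-(x : ℚ_[2]) / y)))
    {x y x' y' : ℚ} (h : V.toAffine.Nonsingular x y) (h' : V.toAffine.Nonsingular x' y')
    (h2Q : ((2 ^ 1 : ℕ)) • (.some x y h : V.toAffine.Point) = .some x' y' h') (hQ' : V.SatisfiesLocalConditions 2 (.some x' y' h'))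
    (hx : ‖(x : ℚ_[2])‖ = 4)
    (hN : (x'.num : ℚ) = (x.num : ℚ) ^ 4 - 2 * V.a₄ * (x.num : ℚ) ^ 2 * (x.den : ℚ) ^ 2
      - 2 * (V.a₃ ^ 2 + 4 * V.a₆) * (x.num : ℚ) * (x.den : ℚ) ^ 3 - (4 * V.a₂ * V.a₆ + V.a₂ * V.a₃ ^ 2 - V.a₄ ^ 2) * (x.den : ℚ) ^ 4) :
    ‖D.pairing (.some x y h) (.some x y h)‖ ≤ 4⁻¹ := by
  have hB := norm_pairing_sub_padicLog_num_add_le_of_duplication V ha1 Sq h0 h1 h2 h3 hODE D hD h h' h2Q hQ' hx hN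
  have hL := norm_padicLog_num_le_of_norm_eq_four V h ha1 hx
  have hA4 : ‖(V.a₄ : ℚ_[2])‖ ≤ 1 := (mem_localIntegers_iff 2 _).mp (V.a₄_mem_localIntegers 2)
  have h8 : ‖(8 : ℚ_[2]) * (V.a₄ : ℚ_[2])‖ ≤ 8⁻¹ := by
    rw [norm_mul, show (8 : ℚ_[2]) = 2 ^ 3 by norm_num, norm_pow, Rank2Observatory.padic_norm_two]
    calc ((2⁻¹ : ℝ) ^ 3) * ‖(V.a₄ : ℚ_[2])‖ ≤ (2⁻¹ : ℝ) ^ 3 * 1 := by gcongr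
      _ = 8⁻¹ := by norm_num
  set H := D.pairing (.some x y h) (.some x y h)
  rw [show H = (H - padicLog 2 (x.num : ℚ_[2]) + 8 * (V.a₄ : ℚ_[2])) + padicLog 2 (x.num : ℚ_[2]) + -(8 * (V.a₄ : ℚ_[2])) by ring]
  refine (IsUltrametricDist.norm_add_le_max _ _).trans (max_le ?_ (by rw [norm_neg]; exact h8.trans (by norm_num)))
  exact (IsUltrametricDist.norm_add_le_max _ _).trans (max_le (hB.trans (by norm_num)) hL)

/-- **THE LEVEL-ONE VALUATION LAW (kernel, given Néron's duplication numerator): `‖⟨Q,Q⟩‖₂ = ¼ ⟺ a₂` is odd** — i.e.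
`v₂⟨Q,Q⟩ = 2` exactly for odd `a₂` and `v₂⟨Q,Q⟩ ≥ 3` for even `a₂`, for every level-one point `Q` of a `ℤ`-integral model with `a₁ = 0`.
(The cell's census CensusAN52: 1 639/1 639 level-one rows.) -/
theorem norm_pairing_eq_quarter_iff_of_duplication (V : WeierstrassCurve ℚ) [V.IsIntegral ℤ] (ha1 : V.a₁ = 0)
    (Sq : ℚ_[2]⟦X⟧) (h0 : constantCoeff Sq = 0) (h1 : coeff 1 Sq = 0) (h2 : coeff 2 Sq = 1) (h3 : coeff 3 Sq = 0)
    (hODE : (V.baseChange ℚ_[2]).SatisfiesSigmaSqODE Sq 0) (D : PAdicHeightData V 2)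
    (hD : ∀ {x y : ℚ} (h : V.toAffine.Nonsingular x y), V.SatisfiesLocalConditions 2 (.some x y h) →
      D.pairing (.some x y h) (.some x y h) = padicLog 2 ((x.den : ℚ) : ℚ_[2]) - padicLog 2 (padicEval Sq (-(x : ℚ_[2]) / y)))
    {x y x' y' : ℚ} (h : V.toAffine.Nonsingular x y) (h' : V.toAffine.Nonsingular x' y')
    (h2Q : ((2 ^ 1 : ℕ)) • (.some x y h : V.toAffine.Point) = .some x' y' h') (hQ' : V.SatisfiesLocalConditions 2 (.some x' y' h'))
    (hx : ‖(x : ℚ_[2])‖ = 4)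
    (hN : (x'.num : ℚ) = (x.num : ℚ) ^ 4 - 2 * V.a₄ * (x.num : ℚ) ^ 2 * (x.den : ℚ) ^ 2
      - 2 * (V.a₃ ^ 2 + 4 * V.a₆) * (x.num : ℚ) * (x.den : ℚ) ^ 3 - (4 * V.a₂ * V.a₆ + V.a₂ * V.a₃ ^ 2 - V.a₄ ^ 2) * (x.den : ℚ) ^ 4)
    (a2 : ℤ) (ha2 : V.a₂ = a2) :
    ‖D.pairing (.some x y h) (.some x y h)‖ = 4⁻¹ ↔ Odd a2 := by
  have hB := norm_pairing_sub_padicLog_num_add_le_of_duplication V ha1 Sq h0 h1 h2 h3 hODE D hD h h' h2Q hQ' hx hN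
  have hiff := norm_padicLog_num_eq_quarter_iff V h ha1 hx a2 ha2
  have hL := norm_padicLog_num_le_of_norm_eq_four V h ha1 hx
  have hA4 : ‖(V.a₄ : ℚ_[2])‖ ≤ 1 := (mem_localIntegers_iff 2 _).mp (V.a₄_mem_localIntegers 2)
  have h8 : ‖(8 : ℚ_[2]) * (V.a₄ : ℚ_[2])‖ ≤ 8⁻¹ := by
    rw [norm_mul, show (8 : ℚ_[2]) = 2 ^ 3 by norm_num, norm_pow, Rank2Observatory.padic_norm_two]
    calc ((2⁻¹ : ℝ) ^ 3) * ‖(V.a₄ : ℚ_[2])‖ ≤ (2⁻¹ : ℝ) ^ 3 * 1 := by gcongr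
      _ = 8⁻¹ := by norm_num
  set H := D.pairing (.some x y h) (.some x y h)
  set Lg := padicLog 2 (x.num : ℚ_[2])
  -- `R := H − Lg` has norm `≤ ⅛`
  have hR : ‖H - Lg‖ ≤ 8⁻¹ := by
    rw [show H - Lg = (H - Lg + 8 * (V.a₄ : ℚ_[2])) + -(8 * (V.a₄ : ℚ_[2])) by ring]
    exact (IsUltrametricDist.norm_add_le_max _ _).trans (max_le (hB.trans (by norm_num)) (by rw [norm_neg]; exact h8))
  rw [← hiff]
  constructor
  · intro hH
    by_contra hne
    have hlt : ‖Lg‖ < 4⁻¹ := lt_of_le_of_ne hL hne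
    have : ‖H‖ < 4⁻¹ := by
      rw [show H = (H - Lg) + Lg by ring]
      refine lt_of_le_of_lt (IsUltrametricDist.norm_add_le_max _ _) (max_lt (lt_of_le_of_lt hR (by norm_num)) hlt)
    rw [hH] at this; exact lt_irrefl _ this
  · intro hLg
    have hne : ‖H - Lg‖ ≠ ‖Lg‖ := by rw [hLg]; exact ne_of_lt (lt_of_le_of_lt hR (by norm_num))
    rw [show H = (H - Lg) + Lg by ring, Padic.add_eq_max_of_ne hne, hLg]
    exact max_eq_right (hR.trans (by norm_num))

end NaiveSigmaLogAtTwo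

end Summit.BirchSwinnertonDyer.BirchSwinnertonDyer.Theorems
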